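/-
COR-CM (cells pub-hodgecm / pub-hodgecm2) — HM-EQUALITY Δ2 / X3, row X3-Char item (F) TREE SIDE at the PIN: the `μ`-block of the
pinned Liu dictionary `HodgeCM.Model.liuDictionaryPin … V I line` (port layer 67) VANISHES at index lines with non-smooth finite
Weil representation; its reading r8 `Thm418C` follows from its clause at the smooth-ω lines.  Origin: seat
`prover-pub-hodgecm-own-htheta-g8-0` (own-htheta gen 8; X3 co-owner; draft gen 7), 2026-08-23.  Theorems only: no definition, no
instance, no named fact, no proof holes; nothing landed is edited or restated.  FRAMING: HC_CM is NOT proved; no COR-CM binder or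
pin is discharged; «Δ2 BRIDGE CLOSED» is NOT claimed; the cite `h418` of `CorCM/PortJoin/Closed.lean` is NOT discharged here.
-/
import Summits.HodgeConjecture.CorCM.B01.Transposition.Item6BlockVanishing
import Summits.HodgeConjecture.HodgeCM.Model.LiuIndexPin
import Literature.NumberTheory.GelbartRogawski1991.CompatibleSplittingCM
import HarnessLib

set_option autoImplicit false

noncomputable section

/-!
# The pinned dictionary: `block i = ⊥` at non-smooth index lines; `Thm418C` from the smooth-ω lines

`liuDictionaryPin hHD hI h₁ h₃ hA V I line = liuDictionaryOfWeilFamilyAut … V (ιVE V) I line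
 = LiuDictionary.ofTower … V I (fun i => {χ // (line i).IsAutChar χ}) (fun i a => (line i).Ω (ιVE V) a.1) (PhiMuLine ι₁ ∘ line) …`
(`Model/LiuDictionaryPin` :172, `Model/LiuDictionaryInstanceLevel` :251 ∕ :355 — all `abbrev`s), so §4 of
`Transposition/Item6BlockVanishing` applies with `χof i a := a.1` (open kernel by `SplitLine.isAutChar_iff`) and `ιV := ιVE V`
(continuous, `continuous_ιVE`):
* **`block_pin_eq_bot_of_not_smooth`** — `(liuDictionaryPin … V I line).block i = ⊥` whenever the finite Weil representation
  `ω_f ∘ (line i).s` is NOT smooth (its `U(V)`-member through `ιVE V`, or its `U(W)`-member), [GR91, Prop 3.1.1] being granted at the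
  line's datum (`hGR`; at the index lines of record `SplitLineE.ofCMOf … hGR` this is the vendored CM splitting datum's
  `CompatibleSplitting`, i.e. `GRConstruction.gru_shape`);
* **`thm418C_pin_of_smooth`** — `(liuDictionaryPin … V I line).Thm418C` FOLLOWS from its clause at the index lines with SMOOTH
  finite Weil representation: the displayed cite `h418` of `CorCM/PortJoin/Closed.lean` ∕ the Δ2 bridge is owed only at the
  smooth-ω lines, the only ones at which [Liu21]'s `ω(μ, ε, χ)` (Def. 4.11: smooth, irreducible admissible) exist.
-/

namespace Summit.HodgeConjecture.CorCM.Transposition.BlockVanishing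

open NumberField
open Literature.AlgebraicGeometry.HodgeTheory Literature.NumberTheory.Automorphic.PicardCM
open Literature.NumberTheory.Automorphic Literature.NumberTheory.Weil1964
open Literature.NumberTheory.GelbartRogawski1991 Literature.NumberTheory.GelbartRogawski1991.UnitaryDualPair
open Literature.NumberTheory.Transcendental (Arapura2012_Cor_15_4_6)
open HodgeCM HodgeCM.Model HodgeCM.Model.TowerCarrier
open HodgeCM.Literature.Theta HodgeCM.Literature.Theta.LiuAlbaneseModuleDatum

variable {L : CMField} {ι₁ : (L : Type) →+* ℂ}

/-- **`block i = ⊥` at an index line of the PINNED dictionary whose finite Weil representation is NOT smooth** (its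
`U(V)`-member read through the frame transport `ιVE V`, or its `U(W)`-member), [GR91, Prop. 3.1.1] being granted at the line's datum.
[cite: GelbartRogawski1991, §3.1 Prop. 3.1.1 p. 455 L1–3, Remark p. 457 L4–13] [cite: BernsteinZelevinsky1976, §2.1] -/
theorem block_pin_eq_bot_of_not_smooth (hHD : exists_isReal_hodgeModel) (hI : hodgePQ_independent_of_hodgeModel)
    (h₁ : BallQuotientUniformised) (h₃ : CMAbelianVarietyRealised) (hA : Arapura2012_Cor_15_4_6)
    (V : HermSpace3 L ι₁) (I : Type) (line : I → SplitLineE V) (i : I)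
    (hGR : (splittingDatum (↥(maximalRealSubfield (L : Type))) (L : Type) (IsCMField.complexConj (L : Type)) 3 1 (line i).e
      (Matrix.diagonal (frameD V)) (line i).JW (complexConj_imagUnit (L : Type)) (imagUnit_ne_zero (L : Type))
      (imagUnit_mul_self (L : Type)) (realDiagonal_isSymm (L : Type) (frameD V) (frameD_real V)) (line i).hW
      (isUnit_det_realDiagonal (L : Type) (frameD V) (frameD_real V) (frameD_ne V)) (line i).hWd
      (realDiagonal_map (L : Type) (frameD V) (frameD_real V)).symm (line i).hJW).CompatibleSplitting)
    (hns : ¬ ((∀ v : FinSB (↥(maximalRealSubfield (L : Type))) (Fin 3 × Fin 1), ∃ K : Subgroup ↥V.adelicFin,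
                  IsOpen (K : Set ↥V.adelicFin) ∧ ∀ g ∈ K,
                    UnitaryDualPair.WeilCoinv.finPairRepV (↥(maximalRealSubfield (L : Type))) (L : Type)
                      (IsCMField.complexConj (L : Type)) 3 1 (line i).e (Matrix.diagonal (frameD V)) (line i).JW
                      (complexConj_imagUnit (L : Type)) (imagUnit_ne_zero (L : Type)) (imagUnit_mul_self (L : Type))
                      (realDiagonal_isSymm (L : Type) (frameD V) (frameD_real V)) (line i).hW
                      (isUnit_det_realDiagonal (L : Type) (frameD V) (frameD_real V) (frameD_ne V)) (line i).hWd
                      (realDiagonal_map (L : Type) (frameD V) (frameD_real V)).symm (line i).hJW (line i).hs (ιVE V g) v = v) ∧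
              ∀ v : FinSB (↥(maximalRealSubfield (L : Type))) (Fin 3 × Fin 1),
                ∃ K : Subgroup _, IsOpen (SetLike.coe K) ∧ ∀ u ∈ K,
                    UnitaryDualPair.WeilCoinv.finPairRepW (↥(maximalRealSubfield (L : Type))) (L : Type)
                      (IsCMField.complexConj (L : Type)) 3 1 (line i).e (Matrix.diagonal (frameD V)) (line i).JW
                      (complexConj_imagUnit (L : Type)) (imagUnit_ne_zero (L : Type)) (imagUnit_mul_self (L : Type))
                      (realDiagonal_isSymm (L : Type) (frameD V) (frameD_real V)) (line i).hW
                      (isUnit_det_realDiagonal (L : Type) (frameD V) (frameD_real V) (frameD_ne V)) (line i).hWd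
                      (realDiagonal_map (L : Type) (frameD V) (frameD_real V)).symm (line i).hJW (line i).hs u v = v)) :
    (liuDictionaryPin hHD hI h₁ h₃ hA V I line).block i = ⊥ :=
  block_ofTower_eq_bot_of_not_smooth V (ιVE V) I (fun i => {χ : (line i).CharW // (line i).IsAutChar χ}) line (fun _ a => a.1)
    (fun i => SplitLine.PhiMuLine ι₁ (line i)) (fun i dd => dd.IsReflexOfTypeG ι₁ (SplitLine.typeOfLine (line i)))
    hHD hI h₁ h₃ hA (continuous_ιVE V) i hGR hns fun a => ((SplitLine.isAutChar_iff _ a.1).1 a.2).1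

/-- **The reading r8 `Thm418C` of the PINNED dictionary FOLLOWS from its clause at the index lines with SMOOTH finite Weil
representation** (both members, the `U(V)`-member through `ιVE V`), [GR91, Prop. 3.1.1] being granted at every line's datum: at the
other lines `block = ⊥` and the clause is vacuous.
[cite: Liu2021, Thm. 4.18 (FJcycle.tex l. 2232–2245)] [cite: GelbartRogawski1991, §3.1 Prop. 3.1.1 p. 455 L1–3, Remark p. 457 L4–13]
[cite: BernsteinZelevinsky1976, §2.1] -/
theorem thm418C_pin_of_smooth (hHD : exists_isReal_hodgeModel) (hI : hodgePQ_independent_of_hodgeModel)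
    (h₁ : BallQuotientUniformised) (h₃ : CMAbelianVarietyRealised) (hA : Arapura2012_Cor_15_4_6)
    (V : HermSpace3 L ι₁) (I : Type) (line : I → SplitLineE V)
    (hGR : ∀ i : I, (splittingDatum (↥(maximalRealSubfield (L : Type))) (L : Type) (IsCMField.complexConj (L : Type)) 3 1
      (line i).e (Matrix.diagonal (frameD V)) (line i).JW (complexConj_imagUnit (L : Type)) (imagUnit_ne_zero (L : Type))
      (imagUnit_mul_self (L : Type)) (realDiagonal_isSymm (L : Type) (frameD V) (frameD_real V)) (line i).hW
      (isUnit_det_realDiagonal (L : Type) (frameD V) (frameD_real V) (frameD_ne V)) (line i).hWd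
      (realDiagonal_map (L : Type) (frameD V) (frameD_real V)).symm (line i).hJW).CompatibleSplitting)
    (h : ∀ i : I, (liuDictionaryPin hHD hI h₁ h₃ hA V I line).PhiMu i →
      ((∀ v : FinSB (↥(maximalRealSubfield (L : Type))) (Fin 3 × Fin 1), ∃ K : Subgroup ↥V.adelicFin,
          IsOpen (K : Set ↥V.adelicFin) ∧ ∀ g ∈ K,
            UnitaryDualPair.WeilCoinv.finPairRepV (↥(maximalRealSubfield (L : Type))) (L : Type)
              (IsCMField.complexConj (L : Type)) 3 1 (line i).e (Matrix.diagonal (frameD V)) (line i).JW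
              (complexConj_imagUnit (L : Type)) (imagUnit_ne_zero (L : Type)) (imagUnit_mul_self (L : Type))
              (realDiagonal_isSymm (L : Type) (frameD V) (frameD_real V)) (line i).hW
              (isUnit_det_realDiagonal (L : Type) (frameD V) (frameD_real V) (frameD_ne V)) (line i).hWd
              (realDiagonal_map (L : Type) (frameD V) (frameD_real V)).symm (line i).hJW (line i).hs (ιVE V g) v = v) ∧
        ∀ v : FinSB (↥(maximalRealSubfield (L : Type))) (Fin 3 × Fin 1),
          ∃ K : Subgroup _, IsOpen (SetLike.coe K) ∧ ∀ u ∈ K,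
              UnitaryDualPair.WeilCoinv.finPairRepW (↥(maximalRealSubfield (L : Type))) (L : Type)
                (IsCMField.complexConj (L : Type)) 3 1 (line i).e (Matrix.diagonal (frameD V)) (line i).JW
                (complexConj_imagUnit (L : Type)) (imagUnit_ne_zero (L : Type)) (imagUnit_mul_self (L : Type))
                (realDiagonal_isSymm (L : Type) (frameD V) (frameD_real V)) (line i).hW
                (isUnit_det_realDiagonal (L : Type) (frameD V) (frameD_real V) (frameD_ne V)) (line i).hWd
                (realDiagonal_map (L : Type) (frameD V) (frameD_real V)).symm (line i).hJW (line i).hs u v = v) →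
      ∃ Γ₀ : Level V, ∀ Γ ≤ Γ₀, ∀ x ∈ (liuDictionaryPin hHD hI h₁ h₃ hA V I line).block i,
        x ∈ fixedBy Γ.K (liuDictionaryPin hHD hI h₁ h₃ hA V I line).H →
          (liuDictionaryPin hHD hI h₁ h₃ hA V I line).res Γ x ∈
            Submodule.span ℂ ((liuDictionaryPin hHD hI h₁ h₃ hA V I line).cmClasses Γ i)) :
    (liuDictionaryPin hHD hI h₁ h₃ hA V I line).Thm418C :=
  thm418C_ofTower_of_smooth V (ιVE V) I (fun i => {χ : (line i).CharW // (line i).IsAutChar χ}) line (fun _ a => a.1)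
    (fun i => SplitLine.PhiMuLine ι₁ (line i)) (fun i dd => dd.IsReflexOfTypeG ι₁ (SplitLine.typeOfLine (line i)))
    hHD hI h₁ h₃ hA (continuous_ιVE V) hGR (fun _ a => ((SplitLine.isAutChar_iff _ a.1).1 a.2).1) h

/-! ### At the theta lane's index lines `LiuIndex.lineOf V ρ P` (port layer 68): no [GR91] hypothesis left

Every index line `LiuIndex.lineOf V ρ P i = SplitLineE.ofCM V e₁ (vec (ρ i.1)) … i.splitting …` carries LITERALLY the vendored CM
splitting datum `cmSplittingDatum L e₁ (frameD V) … (vec (ρ i.1)) …` (`cmSplittingDatum_eq`, `rfl`), at which [GR91, Prop 3.1.1] is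
the tree theorem `GRConstruction.compatibleSplitting_cmSplittingDatum`; `LiuIndex.I V ρ μ` ∕ `LiuIndex.line V ρ μ` (layer 69, the
index of the hM-cone's `h418`) are the instances `P := CentralTypeIs V μ`. -/

/-- **`block i = ⊥` at every index `i : LiuIndex.IOf V ρ P` whose pair splitting has NON-smooth finite Weil representation**, for the
pinned dictionary over the theta lane's index lines — [GR91, Prop. 3.1.1] DISCHARGED by `GRConstruction.compatibleSplitting_cmSplittingDatum`.
[cite: GelbartRogawski1991, §3.1 Prop. 3.1.1 p. 455 L1–3, Remark p. 457 L4–13] [cite: BernsteinZelevinsky1976, §2.1] -/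
theorem block_pin_lineOf_eq_bot_of_not_smooth (hHD : exists_isReal_hodgeModel) (hI : hodgePQ_independent_of_hodgeModel)
    (h₁ : BallQuotientUniformised) (h₃ : CMAbelianVarietyRealised) (hA : Arapura2012_Cor_15_4_6)
    (V : HermSpace3 L ι₁) (ρ : LiuIndex.GramClass L → LiuIndex.RealScalar L)
    (P : ∀ a : LiuIndex.RealScalar L, LiuIndex.SplittingAt V a → Prop) (i : LiuIndex.IOf V ρ P)
    (hns : ¬ ((∀ v : FinSB (↥(maximalRealSubfield (L : Type))) (Fin 3 × Fin 1), ∃ K : Subgroup ↥V.adelicFin,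
                  IsOpen (K : Set ↥V.adelicFin) ∧ ∀ g ∈ K,
                    UnitaryDualPair.WeilCoinv.finPairRepV (↥(maximalRealSubfield (L : Type))) (L : Type)
                      (IsCMField.complexConj (L : Type)) 3 1 ArchSideTerm.e₁ (Matrix.diagonal (frameD V))
                      (Matrix.diagonal (LiuIndex.RealScalar.vec (ρ i.1))) (complexConj_imagUnit (L : Type))
                      (imagUnit_ne_zero (L : Type)) (imagUnit_mul_self (L : Type))
                      (realDiagonal_isSymm (L : Type) (frameD V) (frameD_real V))
                      (realDiagonal_isSymm (L : Type) (LiuIndex.RealScalar.vec (ρ i.1)) (LiuIndex.RealScalar.vec_real (ρ i.1)))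
                      (isUnit_det_realDiagonal (L : Type) (frameD V) (frameD_real V) (frameD_ne V))
                      (isUnit_det_realDiagonal (L : Type) (LiuIndex.RealScalar.vec (ρ i.1)) (LiuIndex.RealScalar.vec_real (ρ i.1))
                        (LiuIndex.RealScalar.vec_ne (ρ i.1)))
                      (realDiagonal_map (L : Type) (frameD V) (frameD_real V)).symm
                      (realDiagonal_map (L : Type) (LiuIndex.RealScalar.vec (ρ i.1)) (LiuIndex.RealScalar.vec_real (ρ i.1))).symm
                      i.2.2.1 (ιVE V g) v = v) ∧
              ∀ v : FinSB (↥(maximalRealSubfield (L : Type))) (Fin 3 × Fin 1),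
                ∃ K : Subgroup _, IsOpen (SetLike.coe K) ∧ ∀ u ∈ K,
                    UnitaryDualPair.WeilCoinv.finPairRepW (↥(maximalRealSubfield (L : Type))) (L : Type)
                      (IsCMField.complexConj (L : Type)) 3 1 ArchSideTerm.e₁ (Matrix.diagonal (frameD V))
                      (Matrix.diagonal (LiuIndex.RealScalar.vec (ρ i.1))) (complexConj_imagUnit (L : Type))
                      (imagUnit_ne_zero (L : Type)) (imagUnit_mul_self (L : Type))
                      (realDiagonal_isSymm (L : Type) (frameD V) (frameD_real V))
                      (realDiagonal_isSymm (L : Type) (LiuIndex.RealScalar.vec (ρ i.1)) (LiuIndex.RealScalar.vec_real (ρ i.1)))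
                      (isUnit_det_realDiagonal (L : Type) (frameD V) (frameD_real V) (frameD_ne V))
                      (isUnit_det_realDiagonal (L : Type) (LiuIndex.RealScalar.vec (ρ i.1)) (LiuIndex.RealScalar.vec_real (ρ i.1))
                        (LiuIndex.RealScalar.vec_ne (ρ i.1)))
                      (realDiagonal_map (L : Type) (frameD V) (frameD_real V)).symm
                      (realDiagonal_map (L : Type) (LiuIndex.RealScalar.vec (ρ i.1)) (LiuIndex.RealScalar.vec_real (ρ i.1))).symm
                      i.2.2.1 u v = v)) :
    (liuDictionaryPin hHD hI h₁ h₃ hA V (LiuIndex.IOf V ρ P) (LiuIndex.lineOf V ρ P)).block i = ⊥ :=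
  block_pin_eq_bot_of_not_smooth hHD hI h₁ h₃ hA V (LiuIndex.IOf V ρ P) (LiuIndex.lineOf V ρ P) i
    (GRConstruction.compatibleSplitting_cmSplittingDatum (L : Type) ArchSideTerm.e₁ (frameD V) (frameD_real V) (frameD_ne V)
      (LiuIndex.RealScalar.vec (ρ i.1)) (LiuIndex.RealScalar.vec_real (ρ i.1)) (LiuIndex.RealScalar.vec_ne (ρ i.1)))
    hns

/-- **`Thm418C` of the pinned dictionary over the theta lane's index lines `LiuIndex.lineOf V ρ P` FOLLOWS from its clause at the
indices with SMOOTH finite Weil representation** — [GR91, Prop. 3.1.1] DISCHARGED (`GRConstruction.compatibleSplitting_cmSplittingDatum`).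
[cite: Liu2021, Thm. 4.18 (FJcycle.tex l. 2232–2245)] [cite: GelbartRogawski1991, §3.1 Prop. 3.1.1 p. 455 L1–3, Remark p. 457 L4–13]
[cite: BernsteinZelevinsky1976, §2.1] -/
theorem thm418C_pin_lineOf_of_smooth (hHD : exists_isReal_hodgeModel) (hI : hodgePQ_independent_of_hodgeModel)
    (h₁ : BallQuotientUniformised) (h₃ : CMAbelianVarietyRealised) (hA : Arapura2012_Cor_15_4_6)
    (V : HermSpace3 L ι₁) (ρ : LiuIndex.GramClass L → LiuIndex.RealScalar L)
    (P : ∀ a : LiuIndex.RealScalar L, LiuIndex.SplittingAt V a → Prop)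
    (h : ∀ i : LiuIndex.IOf V ρ P, (liuDictionaryPin hHD hI h₁ h₃ hA V (LiuIndex.IOf V ρ P) (LiuIndex.lineOf V ρ P)).PhiMu i →
      ((∀ v : FinSB (↥(maximalRealSubfield (L : Type))) (Fin 3 × Fin 1), ∃ K : Subgroup ↥V.adelicFin,
          IsOpen (K : Set ↥V.adelicFin) ∧ ∀ g ∈ K,
            UnitaryDualPair.WeilCoinv.finPairRepV (↥(maximalRealSubfield (L : Type))) (L : Type)
              (IsCMField.complexConj (L : Type)) 3 1 (LiuIndex.lineOf V ρ P i).e (Matrix.diagonal (frameD V)) (LiuIndex.lineOf V ρ P i).JW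
              (complexConj_imagUnit (L : Type)) (imagUnit_ne_zero (L : Type)) (imagUnit_mul_self (L : Type))
              (realDiagonal_isSymm (L : Type) (frameD V) (frameD_real V)) (LiuIndex.lineOf V ρ P i).hW
              (isUnit_det_realDiagonal (L : Type) (frameD V) (frameD_real V) (frameD_ne V)) (LiuIndex.lineOf V ρ P i).hWd
              (realDiagonal_map (L : Type) (frameD V) (frameD_real V)).symm (LiuIndex.lineOf V ρ P i).hJW (LiuIndex.lineOf V ρ P i).hs (ιVE V g) v = v) ∧
        ∀ v : FinSB (↥(maximalRealSubfield (L : Type))) (Fin 3 × Fin 1),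
          ∃ K : Subgroup _, IsOpen (SetLike.coe K) ∧ ∀ u ∈ K,
              UnitaryDualPair.WeilCoinv.finPairRepW (↥(maximalRealSubfield (L : Type))) (L : Type)
                (IsCMField.complexConj (L : Type)) 3 1 (LiuIndex.lineOf V ρ P i).e (Matrix.diagonal (frameD V)) (LiuIndex.lineOf V ρ P i).JW
                (complexConj_imagUnit (L : Type)) (imagUnit_ne_zero (L : Type)) (imagUnit_mul_self (L : Type))
                (realDiagonal_isSymm (L : Type) (frameD V) (frameD_real V)) (LiuIndex.lineOf V ρ P i).hW
                (isUnit_det_realDiagonal (L : Type) (frameD V) (frameD_real V) (frameD_ne V)) (LiuIndex.lineOf V ρ P i).hWd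
                (realDiagonal_map (L : Type) (frameD V) (frameD_real V)).symm (LiuIndex.lineOf V ρ P i).hJW (LiuIndex.lineOf V ρ P i).hs u v = v) →
      ∃ Γ₀ : Level V, ∀ Γ ≤ Γ₀, ∀ x ∈ (liuDictionaryPin hHD hI h₁ h₃ hA V (LiuIndex.IOf V ρ P) (LiuIndex.lineOf V ρ P)).block i,
        x ∈ fixedBy Γ.K (liuDictionaryPin hHD hI h₁ h₃ hA V (LiuIndex.IOf V ρ P) (LiuIndex.lineOf V ρ P)).H →
          (liuDictionaryPin hHD hI h₁ h₃ hA V (LiuIndex.IOf V ρ P) (LiuIndex.lineOf V ρ P)).res Γ x ∈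
            Submodule.span ℂ ((liuDictionaryPin hHD hI h₁ h₃ hA V (LiuIndex.IOf V ρ P) (LiuIndex.lineOf V ρ P)).cmClasses Γ i)) :
    (liuDictionaryPin hHD hI h₁ h₃ hA V (LiuIndex.IOf V ρ P) (LiuIndex.lineOf V ρ P)).Thm418C :=
  thm418C_pin_of_smooth hHD hI h₁ h₃ hA V (LiuIndex.IOf V ρ P) (LiuIndex.lineOf V ρ P)
    (fun i => GRConstruction.compatibleSplitting_cmSplittingDatum (L : Type) ArchSideTerm.e₁ (frameD V) (frameD_real V) (frameD_ne V)
      (LiuIndex.RealScalar.vec (ρ i.1)) (LiuIndex.RealScalar.vec_real (ρ i.1)) (LiuIndex.RealScalar.vec_ne (ρ i.1)))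
    h

end Summit.HodgeConjecture.CorCM.Transposition.BlockVanishing

end
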